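import Literature.Analysis.FluidPDE.ElgindiSineSeries
import HarnessLib

/-!
# The sine coefficients of a function on `[0, π/2]` and the second spectral gap
([Elgindi2021] §7.1, proof of Proposition 7.1)

Topic `Literature/Analysis/FluidPDE`. Proof file (everything proved, no definitions, no named
facts) on the proof path of the named fact
`Literature.Analysis.FluidPDE.Elgindi.ElgindiGhoulMasmoudi2021_stabilityCore`
(`ElgindiStabilityDecomposition.lean`). T. M. Elgindi, Ann. of Math. 194 (2021) =
arXiv:1904.04795, §7.1 proof of Proposition 7.1 (p. 19):

> "`Ψ(R,θ) = Σ_{n∈ℕ}Ψ_n(R)sin(2nθ)`. In particular, `Σ_{n≥2}(4n² − 6)|Ψ_n(R)|² ≤ 2|Ψ_1(R)|² + |F||Ψ|`."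

Continuing `ElgindiSineSeries.lean`: the Fourier coefficients (period `π`) of the odd extension are
the sine coefficients, `c_n = −(2i/π)∫₀^{π/2}φ(x)sin(2nx)dx` (`sineCoeff_eq`), so
`|c_n|² = (4/π²)(∫₀^{π/2}φ sin(2n·))²` (`norm_sq_sineCoeff`); and the mode inequality behind the display
above — the **second Dirichlet gap with the first mode removed**:
`∫₀^{π/2}φ'² ≥ 4∫₀^{π/2}φ² + 12(∫₀^{π/2}φ² − (4/π)(∫₀^{π/2}φ sin2θ)²)` for `φ ∈ C¹`, `φ(0) = φ(π/2) = 0`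
(`sineModes_gap`), i.e. `Σ_n(4n² − 4)|c_n|² ≥ 12Σ_{|n|≥2}|c_n|²`.
-/

noncomputable section

open MeasureTheory Set Real Filter intervalIntegral Complex
open _root_.Topology

namespace Literature.Analysis.FluidPDE

namespace Elgindi

/-! ### Odd and even integrands on a symmetric interval -/

/-- The integral of an odd continuous function over `[−a, a]` vanishes. [folklore] -/
theorem integral_symm_eq_zero_of_odd {g : ℝ → ℝ} (hg : Continuous g) (hodd : ∀ x, g (-x) = -g x) (a : ℝ) :
    ∫ x in (-a)..a, g x = 0 := by
  have i : ∀ c d : ℝ, IntervalIntegrable g volume c d := fun c d => hg.intervalIntegrable c d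
  rw [← integral_add_adjacent_intervals (i (-a) 0) (i 0 a)]
  have := intervalIntegral.integral_comp_neg g (a := 0) (b := a)
  simp only [neg_zero] at this
  rw [← this]
  have e : ∫ x in (0 : ℝ)..a, g (-x) = -∫ x in (0 : ℝ)..a, g x := by
    rw [← intervalIntegral.integral_neg]
    exact intervalIntegral.integral_congr fun x _ => hodd x
  rw [e]; ring

/-- The integral of an even continuous function over `[−a, a]` is twice that over `[0, a]`. [folklore] -/
theorem integral_symm_eq_two_mul_of_even {g : ℝ → ℝ} (hg : Continuous g) (heven : ∀ x, g (-x) = g x) (a : ℝ) :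
    ∫ x in (-a)..a, g x = 2 * ∫ x in (0 : ℝ)..a, g x := by
  have i : ∀ c d : ℝ, IntervalIntegrable g volume c d := fun c d => hg.intervalIntegrable c d
  rw [← integral_add_adjacent_intervals (i (-a) 0) (i 0 a)]
  have := intervalIntegral.integral_comp_neg g (a := 0) (b := a)
  simp only [neg_zero] at this
  rw [← this]
  have e : ∫ x in (0 : ℝ)..a, g (-x) = ∫ x in (0 : ℝ)..a, g x :=
    intervalIntegral.integral_congr fun x _ => heven x
  rw [e]; ring

/-! ### The characters of period `π` -/

/-- `fourier (−n) x = cos(2nx) − i·sin(2nx)` on the circle of length `π/2 − (−π/2) = π`. [folklore] -/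
theorem fourier_neg_halfpi (n : ℤ) (x : ℝ) :
    fourier (-n) (x : AddCircle (π / 2 - -(π / 2))) =
      ((Real.cos (2 * n * x) : ℝ) : ℂ) - ((Real.sin (2 * n * x) : ℝ) : ℂ) * I := by
  rw [fourier_coe_apply]
  have hπ0 : (π : ℂ) ≠ 0 := Complex.ofReal_ne_zero.2 Real.pi_pos.ne'
  have e : (2 * π * I * ((-n : ℤ) : ℂ) * (x : ℂ) / ((π / 2 - -(π / 2) : ℝ) : ℂ)) = ((-(2 * n * x) : ℝ) : ℂ) * I := by
    push_cast
    field_simp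
    ring
  rw [e, Complex.exp_mul_I, ← Complex.ofReal_cos, ← Complex.ofReal_sin, Real.cos_neg, Real.sin_neg]
  push_cast
  ring

/-! ### The sine coefficients -/

/-- **The Fourier coefficients of the odd extension are the sine coefficients**:
`c_n = −(2i/π)∫₀^{π/2}φ(x)sin(2nx)dx`. [cite: Elgindi2021, §7.1 proof of Proposition 7.1 ("Ψ = ΣΨ_n sin(2nθ)") (p. 19 of arXiv:1904.04795)] -/
theorem sineCoeff_eq {φ : ℝ → ℝ} (h0 : φ 0 = 0) (hψ : Continuous (oddExt φ)) (n : ℤ) :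
    fourierCoeffOn neg_half_pi_lt_half_pi (fun x => (oddExt φ x : ℂ)) n =
      -(2 * I / π) * ((∫ x in (0 : ℝ)..(π / 2), φ x * Real.sin (2 * n * x) : ℝ) : ℂ) := by
  rw [fourierCoeffOn_eq_integral]
  have hint : ∀ x ∈ Set.uIcc (-(π / 2)) (π / 2), fourier (-n) (x : AddCircle (π / 2 - -(π / 2))) • (oddExt φ x : ℂ) =
      ((Real.cos (2 * n * x) * oddExt φ x : ℝ) : ℂ) - I * ((Real.sin (2 * n * x) * oddExt φ x : ℝ) : ℂ) := by
    intro x _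
    rw [fourier_neg_halfpi, smul_eq_mul]
    push_cast
    ring
  rw [intervalIntegral.integral_congr hint]
  have hcc : Continuous fun x => Real.cos (2 * n * x) * oddExt φ x := by fun_prop
  have hsc : Continuous fun x => Real.sin (2 * n * x) * oddExt φ x := by fun_prop
  have iA : IntervalIntegrable (fun x => ((Real.cos (2 * n * x) * oddExt φ x : ℝ) : ℂ)) volume (-(π / 2)) (π / 2) :=
    (Complex.continuous_ofReal.comp hcc).intervalIntegrable _ _
  have iB : IntervalIntegrable (fun x => I * ((Real.sin (2 * n * x) * oddExt φ x : ℝ) : ℂ)) volume (-(π / 2)) (π / 2) :=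
    ((Complex.continuous_ofReal.comp hsc).intervalIntegrable _ _).const_mul I
  rw [intervalIntegral.integral_sub iA iB, intervalIntegral.integral_const_mul, intervalIntegral.integral_ofReal,
    intervalIntegral.integral_ofReal]
  -- the cosine part is odd, the sine part even
  have hA : ∫ x in (-(π / 2))..(π / 2), Real.cos (2 * n * x) * oddExt φ x = 0 := by
    refine integral_symm_eq_zero_of_odd hcc (fun x => ?_) _
    rw [oddExt_neg φ h0, show 2 * (n : ℝ) * -x = -(2 * n * x) by ring, Real.cos_neg]; ring
  have hB : ∫ x in (-(π / 2))..(π / 2), Real.sin (2 * n * x) * oddExt φ x =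
      2 * ∫ x in (0 : ℝ)..(π / 2), φ x * Real.sin (2 * n * x) := by
    rw [integral_symm_eq_two_mul_of_even hsc (fun x => ?_) _]
    · congr 1
      refine intervalIntegral.integral_congr fun x hx => ?_
      rw [Set.uIcc_of_le (by positivity)] at hx
      show Real.sin (2 * n * x) * oddExt φ x = φ x * Real.sin (2 * n * x)
      rw [oddExt_of_nonneg φ hx.1]; ring
    · rw [oddExt_neg φ h0, show 2 * (n : ℝ) * -x = -(2 * n * x) by ring, Real.sin_neg]; ring
  rw [hA, hB, Complex.real_smul]
  have hπ0 : (π : ℂ) ≠ 0 := Complex.ofReal_ne_zero.2 Real.pi_pos.ne'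
  push_cast
  field_simp
  ring

/-- **`|c_n|² = (4/π²)(∫₀^{π/2}φ sin(2n·))²`.** [folklore] -/
theorem norm_sq_sineCoeff {φ : ℝ → ℝ} (h0 : φ 0 = 0) (hψ : Continuous (oddExt φ)) (n : ℤ) :
    ‖fourierCoeffOn neg_half_pi_lt_half_pi (fun x => (oddExt φ x : ℂ)) n‖ ^ 2 =
      4 / π ^ 2 * (∫ x in (0 : ℝ)..(π / 2), φ x * Real.sin (2 * n * x)) ^ 2 := by
  rw [sineCoeff_eq h0 hψ n, norm_mul, norm_neg, norm_div, norm_mul, Complex.norm_I, Complex.norm_real,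
    Complex.norm_real, Real.norm_eq_abs, Real.norm_eq_abs, abs_of_pos Real.pi_pos, Complex.norm_ofNat]
  rw [mul_pow, ← sq_abs (∫ x in (0 : ℝ)..(π / 2), φ x * Real.sin (2 * n * x))]
  field_simp
  ring

/-! ### The second gap with the first mode removed -/

/-- **The Dirichlet mode inequality on `[0, π/2]`**: for `φ ∈ C¹(ℝ)` with `φ(0) = φ(π/2) = 0` and
`m = ∫₀^{π/2}φ sin2θ`,
`∫₀^{π/2}φ'² ≥ 4∫₀^{π/2}φ² + 12(∫₀^{π/2}φ² − (4/π)m²)`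
(Parseval: `Σ4n²|c_n|² ≥ 16Σ|c_n|² − 12(|c_1|² + |c_{−1}|²)`, `|c_{±1}|² = 4m²/π²`). [cite: Elgindi2021, §7.1 proof of Proposition 7.1 ("Σ_{n≥2}(4n²−6)|Ψ_n|² ≤ 2|Ψ_1|² + |F||Ψ|") (p. 19 of arXiv:1904.04795)] -/
theorem sineModes_gap {φ : ℝ → ℝ} (hφ : ContDiff ℝ 1 φ) (h0 : φ 0 = 0) (h1 : φ (π / 2) = 0) :
    4 * (∫ x in (0 : ℝ)..(π / 2), φ x ^ 2) +
        12 * ((∫ x in (0 : ℝ)..(π / 2), φ x ^ 2) - 4 / π * (∫ x in (0 : ℝ)..(π / 2), φ x * Real.sin (2 * x)) ^ 2) ≤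
      ∫ x in (0 : ℝ)..(π / 2), deriv φ x ^ 2 := by
  have hψ : Continuous (oddExt φ) := continuous_oddExt hφ h0
  set a : ℤ → ℝ := fun n => ‖fourierCoeffOn neg_half_pi_lt_half_pi (fun x => (oddExt φ x : ℂ)) n‖ ^ 2 with ha
  have hS : HasSum a (2 / π * ∫ x in (0 : ℝ)..(π / 2), φ x ^ 2) := hasSum_sq_sineCoeff h0 hψ
  have hS' : HasSum (fun n : ℤ => 4 * (n : ℝ) ^ 2 * a n) (2 / π * ∫ x in (0 : ℝ)..(π / 2), deriv φ x ^ 2) :=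
    hasSum_sq_sineCoeff_deriv hφ h0 h1
  have ha0 : ∀ n, 0 ≤ a n := fun n => by simp only [ha]; positivity
  -- the finitely supported correction
  set e : ℤ → ℝ := fun n => if n = 0 then 16 * a n else if n = 1 ∨ n = -1 then 12 * a n else 0 with he
  have hE : HasSum e (∑ n ∈ ({0, 1, -1} : Finset ℤ), e n) := by
    refine hasSum_sum_of_ne_finset_zero fun n hn => ?_
    simp only [Finset.mem_insert, Finset.mem_singleton, not_or] at hn
    simp [he, hn.1, hn.2.1, hn.2.2]
  have hEval : ∑ n ∈ ({0, 1, -1} : Finset ℤ), e n = 16 * a 0 + 12 * a 1 + 12 * a (-1) := by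
    rw [Finset.sum_insert (by simp), Finset.sum_insert (by simp), Finset.sum_singleton]
    simp [he]
    ring
  rw [hEval] at hE
  -- termwise comparison `16 a_n − e_n ≤ 4n² a_n`
  have hcmp : ∀ n : ℤ, 16 * a n - e n ≤ 4 * (n : ℝ) ^ 2 * a n := by
    intro n
    simp only [he]
    split_ifs with hn0 hn1
    · subst hn0; simp
    · rcases hn1 with rfl | rfl <;> simp <;> linarith [ha0 1, ha0 (-1)]
    · have hn2 : (2 : ℝ) ≤ |(n : ℝ)| := by
        rw [← Int.cast_abs]
        have : (2 : ℤ) ≤ |n| := by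
          obtain ⟨h1', h2'⟩ := not_or.1 hn1
          rcases le_or_gt 0 n with h | h
          · rw [abs_of_nonneg h]; omega
          · rw [abs_of_neg h]; omega
        exact_mod_cast this
      have h4 : (4 : ℝ) ≤ (n : ℝ) ^ 2 := by
        rw [← sq_abs]; nlinarith
      nlinarith [ha0 n]
  have hle := hasSum_le hcmp ((hS.mul_left 16).sub hE) hS'
  -- the values `a 0 = 0`, `a (±1) = 4m²/π²`
  have hz : a 0 = 0 := by
    simp only [ha]; rw [sineCoeff_zero h0 hψ]; simp
  have hp1 : a 1 = 4 / π ^ 2 * (∫ x in (0 : ℝ)..(π / 2), φ x * Real.sin (2 * x)) ^ 2 := by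
    simp only [ha]; rw [norm_sq_sineCoeff h0 hψ 1]; simp
  have hm1 : a (-1) = 4 / π ^ 2 * (∫ x in (0 : ℝ)..(π / 2), φ x * Real.sin (2 * x)) ^ 2 := by
    simp only [ha]; rw [norm_sq_sineCoeff h0 hψ (-1)]
    have e1 : ∫ x in (0 : ℝ)..(π / 2), φ x * Real.sin (2 * ((-1 : ℤ) : ℝ) * x) =
        -∫ x in (0 : ℝ)..(π / 2), φ x * Real.sin (2 * x) := by
      rw [← intervalIntegral.integral_neg]
      refine intervalIntegral.integral_congr fun x _ => ?_
      simp only [Int.cast_neg, Int.cast_one]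
      rw [show 2 * (-1 : ℝ) * x = -(2 * x) by ring, Real.sin_neg]; ring
    rw [e1, neg_sq]
  rw [hz, hp1, hm1] at hle
  -- clear the factor `2/π`
  have hπ := Real.pi_pos
  have key : 16 * (2 / π * ∫ x in (0 : ℝ)..(π / 2), φ x ^ 2) -
      (16 * 0 + 12 * (4 / π ^ 2 * (∫ x in (0 : ℝ)..(π / 2), φ x * Real.sin (2 * x)) ^ 2) +
        12 * (4 / π ^ 2 * (∫ x in (0 : ℝ)..(π / 2), φ x * Real.sin (2 * x)) ^ 2)) =
      2 / π * (4 * (∫ x in (0 : ℝ)..(π / 2), φ x ^ 2) +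
        12 * ((∫ x in (0 : ℝ)..(π / 2), φ x ^ 2) - 4 / π * (∫ x in (0 : ℝ)..(π / 2), φ x * Real.sin (2 * x)) ^ 2)) := by
    field_simp
    ring
  rw [key] at hle
  have h2π : (0 : ℝ) < 2 / π := by positivity
  exact le_of_mul_le_mul_left hle h2π

/-! ### Polarized Parseval for the sine coefficients -/

/-- The odd extension of a continuous function vanishing at `0` is continuous. [folklore] -/
theorem continuous_oddExt_of_continuous {φ : ℝ → ℝ} (hφ : Continuous φ) (h0 : φ 0 = 0) : Continuous (oddExt φ) := by
  have h : Continuous fun x : ℝ => if 0 ≤ x then φ x else -φ (-x) :=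
    Continuous.if_le hφ (hφ.comp continuous_neg).neg continuous_const continuous_id (fun x hx => by
      rw [← hx]; simp [h0])
  exact h

/-- Additivity of the odd extension. [folklore] -/
theorem oddExt_add (φ g : ℝ → ℝ) (x : ℝ) : oddExt (fun y => φ y + g y) x = oddExt φ x + oddExt g x := by
  by_cases hx : 0 ≤ x
  · simp [oddExt, hx]
  · simp [oddExt, hx]; ring

/-- Subtractivity of the odd extension. [folklore] -/
theorem oddExt_sub (φ g : ℝ → ℝ) (x : ℝ) : oddExt (fun y => φ y - g y) x = oddExt φ x - oddExt g x := by
  by_cases hx : 0 ≤ x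
  · simp [oddExt, hx]
  · simp [oddExt, hx]; ring

/-- **Polarized Parseval for the sine coefficients**: with `b_n(h) = ∫₀^{π/2}h(x)sin(2nx)dx`,
`Σ_{n∈ℤ} b_n(φ)b_n(g) = (π/2)∫₀^{π/2}φg` for continuous `φ, g` vanishing at `0`
(so `Σ_{n≥1}b_n(φ)b_n(g) = (π/4)∫₀^{π/2}φg`: "`0 = (4/π)Σ_nΨ_n∫₀^{π/2}sinθcos²θ sin(2nθ)dθ`"). [cite: Elgindi2021, §7.1 proof of Proposition 7.1 (p. 19 of arXiv:1904.04795)] -/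
theorem hasSum_sineCoeff_mul {φ g : ℝ → ℝ} (hφ : Continuous φ) (hg : Continuous g) (hφ0 : φ 0 = 0) (hg0 : g 0 = 0) :
    HasSum (fun n : ℤ => (∫ x in (0 : ℝ)..(π / 2), φ x * Real.sin (2 * n * x)) *
        ∫ x in (0 : ℝ)..(π / 2), g x * Real.sin (2 * n * x))
      (π / 2 * ∫ x in (0 : ℝ)..(π / 2), φ x * g x) := by
  -- Parseval for `φ + g` and `φ − g`
  have hp0 : (fun y => φ y + g y) 0 = 0 := by simp [hφ0, hg0]
  have hm0 : (fun y => φ y - g y) 0 = 0 := by simp [hφ0, hg0]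
  have hpc' : Continuous fun y => φ y + g y := hφ.add hg
  have hmc' : Continuous fun y => φ y - g y := hφ.sub hg
  have hpc : Continuous (oddExt fun y => φ y + g y) := continuous_oddExt_of_continuous hpc' hp0
  have hmc : Continuous (oddExt fun y => φ y - g y) := continuous_oddExt_of_continuous hmc' hm0
  have hP := hasSum_sq_sineCoeff hp0 hpc
  have hM := hasSum_sq_sineCoeff hm0 hmc
  have h := hP.sub hM
  -- identify the terms
  have hb : ∀ (h : ℝ → ℝ) (n : ℤ), Continuous h →
      IntervalIntegrable (fun x => h x * Real.sin (2 * n * x)) volume 0 (π / 2) := fun h n hh =>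
    (hh.mul (by fun_prop)).intervalIntegrable _ _
  have eterm : ∀ n : ℤ, ‖fourierCoeffOn neg_half_pi_lt_half_pi (fun x => (oddExt (fun y => φ y + g y) x : ℂ)) n‖ ^ 2 -
      ‖fourierCoeffOn neg_half_pi_lt_half_pi (fun x => (oddExt (fun y => φ y - g y) x : ℂ)) n‖ ^ 2 =
      16 / π ^ 2 * ((∫ x in (0 : ℝ)..(π / 2), φ x * Real.sin (2 * n * x)) *
        ∫ x in (0 : ℝ)..(π / 2), g x * Real.sin (2 * n * x)) := by
    intro n
    rw [norm_sq_sineCoeff hp0 hpc, norm_sq_sineCoeff hm0 hmc]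
    have e1 : ∫ x in (0 : ℝ)..(π / 2), (φ x + g x) * Real.sin (2 * n * x) =
        (∫ x in (0 : ℝ)..(π / 2), φ x * Real.sin (2 * n * x)) + ∫ x in (0 : ℝ)..(π / 2), g x * Real.sin (2 * n * x) := by
      rw [← intervalIntegral.integral_add (hb φ n hφ) (hb g n hg)]
      exact intervalIntegral.integral_congr fun x _ => by ring
    have e2 : ∫ x in (0 : ℝ)..(π / 2), (φ x - g x) * Real.sin (2 * n * x) =
        (∫ x in (0 : ℝ)..(π / 2), φ x * Real.sin (2 * n * x)) - ∫ x in (0 : ℝ)..(π / 2), g x * Real.sin (2 * n * x) := by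
      rw [← intervalIntegral.integral_sub (hb φ n hφ) (hb g n hg)]
      exact intervalIntegral.integral_congr fun x _ => by ring
    rw [e1, e2]
    ring
  have etot : 2 / π * (∫ x in (0 : ℝ)..(π / 2), (φ x + g x) ^ 2) -
      2 / π * (∫ x in (0 : ℝ)..(π / 2), (φ x - g x) ^ 2) =
      16 / π ^ 2 * (π / 2 * ∫ x in (0 : ℝ)..(π / 2), φ x * g x) := by
    have i1 : IntervalIntegrable (fun x => (φ x + g x) ^ 2) volume 0 (π / 2) := ((hφ.add hg).pow 2).intervalIntegrable _ _
    have i2 : IntervalIntegrable (fun x => (φ x - g x) ^ 2) volume 0 (π / 2) := ((hφ.sub hg).pow 2).intervalIntegrable _ _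
    have e : (∫ x in (0 : ℝ)..(π / 2), (φ x + g x) ^ 2) - ∫ x in (0 : ℝ)..(π / 2), (φ x - g x) ^ 2 =
        4 * ∫ x in (0 : ℝ)..(π / 2), φ x * g x := by
      rw [← intervalIntegral.integral_sub i1 i2, ← intervalIntegral.integral_const_mul]
      exact intervalIntegral.integral_congr fun x _ => by ring
    rw [← mul_sub, e]
    field_simp
    ring
  simp only [eterm] at h
  rw [etot] at h
  have h16 : (16 / π ^ 2 : ℝ) ≠ 0 := by positivity
  have := h.mul_left (π ^ 2 / 16)
  have hc : (π ^ 2 / 16 * (16 / π ^ 2) : ℝ) = 1 := by field_simp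
  have e3 : (fun i : ℤ => π ^ 2 / 16 * (16 / π ^ 2 * ((∫ x in (0 : ℝ)..(π / 2), φ x * Real.sin (2 * i * x)) *
      ∫ x in (0 : ℝ)..(π / 2), g x * Real.sin (2 * i * x)))) =
      fun i : ℤ => (∫ x in (0 : ℝ)..(π / 2), φ x * Real.sin (2 * i * x)) *
        ∫ x in (0 : ℝ)..(π / 2), g x * Real.sin (2 * i * x) := by
    funext i; rw [← mul_assoc, hc, one_mul]
  have e4 : π ^ 2 / 16 * (16 / π ^ 2 * (π / 2 * ∫ x in (0 : ℝ)..(π / 2), φ x * g x)) =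
      π / 2 * ∫ x in (0 : ℝ)..(π / 2), φ x * g x := by
    rw [← mul_assoc, hc, one_mul]
  rw [e3, e4] at this
  exact this


end Elgindi

end Literature.Analysis.FluidPDE
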